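import Mathlib
import Summits.CriticalPhenomena.PercolationContinuityZ3.Theorems.PercNearOneGluingAdditiveGluingSigmaRecursion
import Summits.CriticalPhenomena.PercolationContinuityZ3.Theorems.PercNearOneGluingAdditiveGluingSigmaLaw
import Summits.CriticalPhenomena.PercolationContinuityZ3.Theorems.PercNearOneGluingAdditiveGluingSigmaGeometry
import Summits.CriticalPhenomena.PercolationContinuityZ3.Theorems.PercNearOneGluingAdditiveGluingGluingLemma5
import Summits.CriticalPhenomena.PercolationContinuityZ3.Theorems.PercNearOneGluingAdditiveGluingGoodStep24Engine
import HarnessLib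

/-!
# `NoHeavyLowerTail` (stmt-CriticalPhenomena-4575) — additive gluing with constant = the number of
# designated witnesses (witness SWITCHING costs one `t` per witness), any observer depth

Support file (hull-port / coupling seat `prim-hp-1` gen 5; `--supports stmt-CriticalPhenomena-4575`).
No definitions, no named facts, no sorries.  Interpolates between `…UniformWitnessGluing` (one witness,
constant `1`) and the open crux (unboundedly many pocket-dependent witnesses).

Setting: `μ = prodBernoulli w` on the pairs of `Fin n`, relays `A`, `b ∈ A`, a Steiner region `R` disjoint
from `A` and closed under positive pairs towards non-relays, an observer `o ∈ R`, and a WITNESS SET `D ⊆ A`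
such that for every `U` with `o ∈ U ⊆ R` SOME `a ∈ D` is `kill_U`-dominated by every relay receiving a
positive pair from `U` (`P_{G−U}(a ↔ b) ≤ P_{G−U}(v ↔ b)`); the dominated witness may change with `U`.

* `sigmaRec_engine_multi` — the σ-recursion engine of Kozma–Nitzan (arXiv:2401.12397, proofs of Thms 4–5;
  tree file `…AdditiveGluingSigmaRecursion`) with a FINITE SET of comparison relays: per positive layer
  meeting `A` some `a ∈ D` is beaten by the glued layer, per Steiner layer the deficit is at most
  `Σ_{a∈D} μ'(a ↮ b)`; conclusion `μ(O ↔ A) − μ(O ↔ b) ≤ Σ_{a∈D} (1 − μ(a ↔ b))` (each witness re-sums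
  separately through the layer decomposition).
* `fewWitness_blockGluing` — block form, induction on active non-relay vertices outside the block
  (`kill_{U'} ∘ kill_O = kill_{O ∪ U'}` transports the hypothesis; KN Lemma 5 = `stub_gluingLemma5`).
* `nearOneGluing_of_fewWitnesses` — **`P(o ↔ A) − P(o ↔ b) ≤ Σ_{a∈D} P(a ↮ b)`**, hence
  `≤ |D|·t` when every witness is `(1−t)`-reliable (`nearOneGluing_of_fewWitnesses_le`).

Reading (memo HULLPORT-COUPLING.md §43): between the exact Steiner-pocket decomposition and additive
gluing, the only loss is WITNESS SWITCHING, and it costs at most one `t` per distinct designated witness;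
k-uniform near-one gluing for a class of instances ⟸ a bounded number of pocket-designated witnesses.
-/

namespace Summit.CriticalPhenomena.PercolationContinuityZ3.Theorems

open MeasureTheory Set
open Literature.Probability.LatticeModels (prodBernoulli)
open Literature.Probability.Percolation (BondConfig openConn openGraph)

noncomputable section
open Classical

variable {n : ℕ}

/-! ### The engine with a finite witness set -/

/-- **σ-recursion engine with a finite witness set.**  Abstract ingredients as in `sigmaRec_engine`
(`p` glued weights of the block `O`, `q S` the layer worlds, `Ψ` the configuration map, `K` the conull
clique event, geometry for `{O ↔ A}`, `{O ↔ b}` and `{a ↔ b}` (`a ∈ D`), law of the decomposition), plus: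
on every positive layer meeting `A` (missing `b`) some witness `a ∈ D` has `μ'(a ↔ b) ≤ μ'(S ↔ b)`
(`hL5`), and on every non-empty positive Steiner layer the deficit is `≤ Σ_{a∈D} (1 − μ'(a ↔ b))` (`hdef`).
Conclusion: `μ_p(O ↔ A) − μ_p(O ↔ b) ≤ Σ_{a∈D} (1 − μ_p(a ↔ b))`.
[cite: KozmaNitzan2024, proofs of Thms 4–5 (pp. 13–14) — bookkeeping] -/
theorem sigmaRec_engine_multi (w p : Sym2 (Fin n) → unitInterval)
    (q : Finset (Fin n) → Sym2 (Fin n) → unitInterval) (O A D : Finset (Fin n)) (b : Fin n)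
    (Ψ : Finset (Fin n) → BondConfig (Fin n) → BondConfig (Fin n)) (K : Set (BondConfig (Fin n)))
    (hK : ∀ ω, ω ∉ K → ∃ e, p e = 1 ∧ e ∉ ω)
    (hpO : ∀ o x : Fin n, x ∉ O → p s(o, x) = w s(o, x))
    (hgeoA : ∀ (S : Finset (Fin n)) (ω : BondConfig (Fin n)),
      (∀ x : Fin n, x ∈ S ↔ (x ∉ O ∧ ∃ o ∈ O, s(o, x) ∈ ω)) → ω ∈ K →
      (ω ∈ (⋃ o ∈ O, ⋃ x ∈ A, openConn o x) ↔ Ψ S ω ∈ (⋃ s ∈ S, ⋃ x ∈ A, openConn s x)))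
    (hgeob : ∀ (S : Finset (Fin n)) (ω : BondConfig (Fin n)),
      (∀ x : Fin n, x ∈ S ↔ (x ∉ O ∧ ∃ o ∈ O, s(o, x) ∈ ω)) → ω ∈ K →
      (ω ∈ (⋃ o ∈ O, openConn o b) ↔ Ψ S ω ∈ (⋃ s ∈ S, openConn s b)))
    (hgeoD : ∀ a ∈ D, ∀ (S : Finset (Fin n)) (ω : BondConfig (Fin n)),
      (∀ x : Fin n, x ∈ S ↔ (x ∉ O ∧ ∃ o ∈ O, s(o, x) ∈ ω)) → ω ∈ K →
      (ω ∈ openConn a b ↔ Ψ S ω ∈ openConn a b))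
    (hlaw : ∀ (S : Finset (Fin n)) (E : Set (BondConfig (Fin n))),
      (prodBernoulli p).real
          ({ω | ∀ x : Fin n, x ∈ S ↔ (x ∉ O ∧ ∃ o ∈ O, s(o, x) ∈ ω)} ∩ {ω | Ψ S ω ∈ E}) =
        (prodBernoulli p).real {ω | ∀ x : Fin n, x ∈ S ↔ (x ∉ O ∧ ∃ o ∈ O, s(o, x) ∈ ω)} *
          (prodBernoulli (q S)).real E)
    (hL5 : ∀ S : Finset (Fin n), (∀ x ∈ S, x ∉ O ∧ ∃ o ∈ O, w s(o, x) ≠ 0) →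
      (S ∩ A).Nonempty → b ∉ S → ∃ a ∈ D,
      (prodBernoulli (q S)).real (openConn a b) ≤
        (prodBernoulli (q S)).real (⋃ s ∈ S, openConn s b))
    (hdef : ∀ S : Finset (Fin n), (∀ x ∈ S, x ∉ O ∧ ∃ o ∈ O, w s(o, x) ≠ 0) →
      S.Nonempty → Disjoint S A → b ∉ S →
      (prodBernoulli (q S)).real (⋃ s ∈ S, ⋃ x ∈ A, openConn s x) -
          (prodBernoulli (q S)).real (⋃ s ∈ S, openConn s b) ≤
        ∑ a ∈ D, (1 - (prodBernoulli (q S)).real (openConn a b))) :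
    (prodBernoulli p).real (⋃ o ∈ O, ⋃ x ∈ A, openConn o x) -
        (prodBernoulli p).real (⋃ o ∈ O, openConn o b) ≤
      ∑ a ∈ D, (1 - (prodBernoulli p).real (openConn a b)) := by
  have hKc : prodBernoulli p Kᶜ = 0 := sigmaRec_conull p K hK
  -- abbreviation for the layer masses
  set c : Finset (Fin n) → ℝ := fun S =>
    (prodBernoulli p).real {ω | ∀ x : Fin n, x ∈ S ↔ (x ∉ O ∧ ∃ o ∈ O, s(o, x) ∈ ω)} with hc
  have hfac : ∀ (S : Finset (Fin n)) (F F' : Set (BondConfig (Fin n))),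
      (∀ ω : BondConfig (Fin n), (∀ x : Fin n, x ∈ S ↔ (x ∉ O ∧ ∃ o ∈ O, s(o, x) ∈ ω)) →
        ω ∈ K → (ω ∈ F ↔ Ψ S ω ∈ F')) →
      (prodBernoulli p).real
          ({ω | ∀ x : Fin n, x ∈ S ↔ (x ∉ O ∧ ∃ o ∈ O, s(o, x) ∈ ω)} ∩ F) =
        c S * (prodBernoulli (q S)).real F' := by
    intro S F F' hFF'
    rw [hc, ← hlaw S F']
    exact sigmaRec_inter_congr p hKc fun ω hL hKω => hFF' ω hL hKω
  have hA : (prodBernoulli p).real (⋃ o ∈ O, ⋃ x ∈ A, openConn o x) =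
      ∑ S : Finset (Fin n), c S * (prodBernoulli (q S)).real (⋃ s ∈ S, ⋃ x ∈ A, openConn s x) := by
    rw [sigmaRec_partition p O]
    exact Finset.sum_congr rfl fun S _ => hfac S _ _ (hgeoA S)
  have hb : (prodBernoulli p).real (⋃ o ∈ O, openConn o b) =
      ∑ S : Finset (Fin n), c S * (prodBernoulli (q S)).real (⋃ s ∈ S, openConn s b) := by
    rw [sigmaRec_partition p O]
    exact Finset.sum_congr rfl fun S _ => hfac S _ _ (hgeob S)
  have hab : ∀ a ∈ D, (prodBernoulli p).real (openConn a b) =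
      ∑ S : Finset (Fin n), c S * (prodBernoulli (q S)).real (openConn a b) := by
    intro a ha
    rw [sigmaRec_partition p O]
    exact Finset.sum_congr rfl fun S _ => hfac S _ _ (hgeoD a ha S)
  have hone : ∑ S : Finset (Fin n), c S = 1 := by
    have h := sigmaRec_partition p O Set.univ
    simp only [Set.inter_univ, probReal_univ] at h
    rw [hc]
    exact h.symm
  have hcnn : ∀ S, 0 ≤ c S := fun S => measureReal_nonneg
  -- rewrite the right-hand side as a sum over layers
  have hR : ∑ a ∈ D, (1 - (prodBernoulli p).real (openConn a b)) =
      ∑ S : Finset (Fin n), c S * ∑ a ∈ D, (1 - (prodBernoulli (q S)).real (openConn a b)) := by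
    have h1 : ∀ a ∈ D, 1 - (prodBernoulli p).real (openConn a b) =
        ∑ S : Finset (Fin n), c S * (1 - (prodBernoulli (q S)).real (openConn a b)) := by
      intro a ha
      rw [hab a ha]
      simp only [mul_sub, mul_one, Finset.sum_sub_distrib, hone]
    rw [Finset.sum_congr rfl h1, Finset.sum_comm]
    exact Finset.sum_congr rfl fun S _ => by rw [Finset.mul_sum]
  rw [hA, hb, hR, ← Finset.sum_sub_distrib]
  refine Finset.sum_le_sum fun S _ => ?_
  rw [← mul_sub]
  rcases eq_or_ne (c S) 0 with h0 | h0
  · rw [h0, zero_mul, zero_mul]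
  refine mul_le_mul_of_nonneg_left ?_ (hcnn S)
  -- the termwise inequality on a positive layer
  have hS := sigmaRec_posLayer w p O S hpO h0
  have hα : (prodBernoulli (q S)).real (⋃ s ∈ S, ⋃ x ∈ A, openConn s x) ≤ 1 := measureReal_le_one
  have hβ : 0 ≤ (prodBernoulli (q S)).real (⋃ s ∈ S, openConn s b) := measureReal_nonneg
  have hsum0 : 0 ≤ ∑ a ∈ D, (1 - (prodBernoulli (q S)).real (openConn a b)) :=
    Finset.sum_nonneg fun a _ => sub_nonneg.2 measureReal_le_one
  by_cases hSe : S = ∅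
  · subst hSe
    have h00 : (prodBernoulli (q ∅)).real
        (⋃ s ∈ (∅ : Finset (Fin n)), ⋃ x ∈ A, openConn s x) = 0 := by simp
    linarith
  by_cases hbS : b ∈ S
  · have h1 : (prodBernoulli (q S)).real (⋃ s ∈ S, openConn s b) = 1 := by
      have huniv : (⋃ s ∈ S, openConn s b : Set (BondConfig (Fin n))) = Set.univ :=
        Set.eq_univ_of_forall fun ω =>
          Set.mem_iUnion₂.2 ⟨b, hbS, (SimpleGraph.Reachable.refl b : ω ∈ openConn b b)⟩
      rw [huniv, probReal_univ]
    linarith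
  by_cases hSA : (S ∩ A).Nonempty
  · obtain ⟨a, haD, h5⟩ := hL5 S hS hSA hbS
    have hterm : 1 - (prodBernoulli (q S)).real (openConn a b) ≤
        ∑ a ∈ D, (1 - (prodBernoulli (q S)).real (openConn a b)) :=
      Finset.single_le_sum (f := fun a => 1 - (prodBernoulli (q S)).real (openConn a b))
        (fun a _ => sub_nonneg.2 measureReal_le_one) haD
    linarith
  · exact hdef S hS (Finset.nonempty_iff_ne_empty.2 hSe)
      (Finset.disjoint_iff_inter_eq_empty.2 (Finset.not_nonempty_iff_eq_empty.1 hSA)) hbS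

/-! ### Few witnesses: block form and observer form -/

/-- **Additive gluing with a finite witness set (block form, any depth).**  Relays `A`, `b ∈ A`, witnesses
`D ⊆ A`, a region `R` disjoint from `A`.  For every `m`, every weight function `w` under which `R` is closed
and every block `O ⊆ R` with at most `m` active non-relay vertices outside `O`: if for every `O ⊆ U ⊆ R` and
every relay `v` receiving a positive pair from `U` some witness `a ∈ D` has
`P_{kill_U w}(a ↔ b) ≤ P_{kill_U w}(v ↔ b)`, then
`μ_{glue O}(O ↔ A) − μ_{glue O}(O ↔ b) ≤ Σ_{a∈D} (1 − μ_{glue O}(a ↔ b))`.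
[cite: KozmaNitzan2024, Thm. 4 and Lemma 5 (pp. 12–14) — the one-layer, one-witness case] -/
theorem fewWitness_blockGluing (A D : Finset (Fin n)) (b : Fin n) (hbA : b ∈ A) (hDA : D ⊆ A)
    (R : Finset (Fin n)) (hRA : Disjoint R A) :
    ∀ (m : ℕ) (w : Sym2 (Fin n) → unitInterval) (O : Finset (Fin n)), O ⊆ R →
      (∀ x ∈ R, ∀ y : Fin n, y ∉ R → y ∉ A → w s(x, y) = 0) →
      (∀ U : Finset (Fin n), O ⊆ U → U ⊆ R → ∀ v ∈ A, (∃ x ∈ U, w s(x, v) ≠ 0) → ∃ a ∈ D,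
        (prodBernoulli (fun e : Sym2 (Fin n) => if (∃ x ∈ e, x ∈ U) then 0 else w e)).real
            (openConn a b) ≤
          (prodBernoulli (fun e : Sym2 (Fin n) => if (∃ x ∈ e, x ∈ U) then 0 else w e)).real
            (openConn v b)) →
      (Finset.univ.filter fun x : Fin n =>
          x ∉ A ∧ x ∉ O ∧ ∃ y : Fin n, w s(x, y) ≠ 0).card ≤ m →
      (prodBernoulli (fun e : Sym2 (Fin n) =>
          if (∀ x ∈ e, x ∈ O) ∧ ¬ e.IsDiag then 1 else w e)).real
          (⋃ o ∈ O, ⋃ x ∈ A, openConn o x) -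
        (prodBernoulli (fun e : Sym2 (Fin n) =>
          if (∀ x ∈ e, x ∈ O) ∧ ¬ e.IsDiag then 1 else w e)).real
          (⋃ o ∈ O, openConn o b) ≤
        ∑ a ∈ D, (1 - (prodBernoulli (fun e : Sym2 (Fin n) =>
          if (∀ x ∈ e, x ∈ O) ∧ ¬ e.IsDiag then 1 else w e)).real (openConn a b)) := by
  intro m
  induction m with
  | zero =>
    intro w O hOR hclosed hdom hcard
    exact step w O hOR hclosed hdom (fun S hS hSne hSA _ => by
      exfalso
      obtain ⟨x, hx⟩ := hSne
      obtain ⟨hxO, o, ho, hw⟩ := hS x hx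
      have hxA : x ∉ A := Finset.disjoint_left.1 hSA hx
      have hmem : x ∈ Finset.univ.filter fun x : Fin n =>
          x ∉ A ∧ x ∉ O ∧ ∃ y : Fin n, w s(x, y) ≠ 0 :=
        Finset.mem_filter.2 ⟨Finset.mem_univ _, hxA, hxO, o, by rwa [Sym2.eq_swap]⟩
      have := Finset.card_pos.2 ⟨x, hmem⟩
      omega)
  | succ m ih =>
    intro w O hOR hclosed hdom hcard
    exact step w O hOR hclosed hdom (fun S hS hSne hSA _ => by
      have hSR : S ⊆ R := by
        intro x hx
        obtain ⟨hxO, o, ho, hw⟩ := hS x hx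
        by_contra hxR
        exact hw (hclosed o (hOR ho) x hxR (Finset.disjoint_left.1 hSA hx))
      refine ih (fun e : Sym2 (Fin n) => if (∃ x ∈ e, x ∈ O) then 0 else w e) S hSR ?_ ?_ ?_
      · intro x hx y hyR hyA
        show (if (∃ z ∈ s(x, y), z ∈ O) then (0 : unitInterval) else w s(x, y)) = 0
        rw [hclosed x hx y hyR hyA]
        split_ifs <;> rfl
      · intro U' hSU' hU'R v hv hadj
        have hkk : (fun e : Sym2 (Fin n) => if (∃ x ∈ e, x ∈ U') then (0 : unitInterval) else
            (if (∃ x ∈ e, x ∈ O) then 0 else w e)) =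
            (fun e : Sym2 (Fin n) => if (∃ x ∈ e, x ∈ O ∪ U') then 0 else w e) := by
          funext e
          by_cases h1 : ∃ x ∈ e, x ∈ U'
          · obtain ⟨x, hx, hxU⟩ := h1
            rw [if_pos ⟨x, hx, hxU⟩, if_pos ⟨x, hx, Finset.mem_union_right O hxU⟩]
          · rw [if_neg h1]
            by_cases h2 : ∃ x ∈ e, x ∈ O
            · obtain ⟨x, hx, hxO⟩ := h2
              rw [if_pos ⟨x, hx, hxO⟩, if_pos ⟨x, hx, Finset.mem_union_left U' hxO⟩]
            · rw [if_neg h2, if_neg]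
              rintro ⟨x, hx, hxOU⟩
              rcases Finset.mem_union.1 hxOU with h | h
              · exact h2 ⟨x, hx, h⟩
              · exact h1 ⟨x, hx, h⟩
        rw [hkk]
        refine hdom (O ∪ U') Finset.subset_union_left (Finset.union_subset hOR hU'R) v hv ?_
        obtain ⟨x, hxU', hwx⟩ := hadj
        have hO : ¬ (∃ z ∈ s(x, v), z ∈ O) := fun h => hwx (by
          show (if (∃ z ∈ s(x, v), z ∈ O) then (0 : unitInterval) else w s(x, v)) = 0
          rw [if_pos h])
        have hwx' : w s(x, v) ≠ 0 := by
          intro h0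
          apply hwx
          show (if (∃ z ∈ s(x, v), z ∈ O) then (0 : unitInterval) else w s(x, v)) = 0
          rw [if_neg hO, h0]
        exact ⟨x, Finset.mem_union_right O hxU', hwx'⟩
      · have hsub : (Finset.univ.filter fun x : Fin n =>
              x ∉ A ∧ x ∉ S ∧ ∃ y : Fin n,
                (if (∃ z ∈ s(x, y), z ∈ O) then (0 : unitInterval) else w s(x, y)) ≠ 0) ⊂
            (Finset.univ.filter fun x : Fin n => x ∉ A ∧ x ∉ O ∧ ∃ y : Fin n, w s(x, y) ≠ 0) := by
          rw [Finset.ssubset_iff_subset_ne]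
          refine ⟨fun x hx => ?_, fun heq => ?_⟩
          · obtain ⟨-, hxA, hxS, y, hy⟩ := Finset.mem_filter.1 hx
            have hO : ¬ (∃ z ∈ s(x, y), z ∈ O) := fun h => hy (by rw [if_pos h])
            rw [if_neg hO] at hy
            exact Finset.mem_filter.2 ⟨Finset.mem_univ _, hxA,
              fun hxO => hO ⟨x, Sym2.mem_mk_left x y, hxO⟩, y, hy⟩
          · obtain ⟨x, hx⟩ := hSne
            obtain ⟨hxO, o, ho, hw⟩ := hS x hx
            have hxA : x ∉ A := Finset.disjoint_left.1 hSA hx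
            have hmem : x ∈ Finset.univ.filter fun x : Fin n =>
                x ∉ A ∧ x ∉ O ∧ ∃ y : Fin n, w s(x, y) ≠ 0 :=
              Finset.mem_filter.2 ⟨Finset.mem_univ _, hxA, hxO, o, by rwa [Sym2.eq_swap]⟩
            rw [← heq] at hmem
            exact (Finset.mem_filter.1 hmem).2.2.1 hx
        have hlt := Finset.card_lt_card hsub
        omega)
  where
  /-- One application of the multi-witness engine at the block `O`. -/
  step (w : Sym2 (Fin n) → unitInterval) (O : Finset (Fin n)) (hOR : O ⊆ R)
      (hclosed : ∀ x ∈ R, ∀ y : Fin n, y ∉ R → y ∉ A → w s(x, y) = 0)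
      (hdom : ∀ U : Finset (Fin n), O ⊆ U → U ⊆ R → ∀ v ∈ A, (∃ x ∈ U, w s(x, v) ≠ 0) → ∃ a ∈ D,
        (prodBernoulli (fun e : Sym2 (Fin n) => if (∃ x ∈ e, x ∈ U) then 0 else w e)).real
            (openConn a b) ≤
          (prodBernoulli (fun e : Sym2 (Fin n) => if (∃ x ∈ e, x ∈ U) then 0 else w e)).real
            (openConn v b))
      (hSteiner : ∀ S : Finset (Fin n), (∀ x ∈ S, x ∉ O ∧ ∃ o ∈ O, w s(o, x) ≠ 0) →
        S.Nonempty → Disjoint S A → b ∉ S →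
        (prodBernoulli (fun e : Sym2 (Fin n) =>
            if (∀ x ∈ e, x ∈ S) ∧ ¬ e.IsDiag then 1 else
              if (∃ x ∈ e, x ∈ O) then 0 else w e)).real (⋃ s ∈ S, ⋃ x ∈ A, openConn s x) -
          (prodBernoulli (fun e : Sym2 (Fin n) =>
            if (∀ x ∈ e, x ∈ S) ∧ ¬ e.IsDiag then 1 else
              if (∃ x ∈ e, x ∈ O) then 0 else w e)).real (⋃ s ∈ S, openConn s b) ≤
          ∑ a ∈ D, (1 - (prodBernoulli (fun e : Sym2 (Fin n) =>
            if (∀ x ∈ e, x ∈ S) ∧ ¬ e.IsDiag then 1 else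
              if (∃ x ∈ e, x ∈ O) then 0 else w e)).real (openConn a b))) :
      (prodBernoulli (fun e : Sym2 (Fin n) =>
          if (∀ x ∈ e, x ∈ O) ∧ ¬ e.IsDiag then 1 else w e)).real
          (⋃ o ∈ O, ⋃ x ∈ A, openConn o x) -
        (prodBernoulli (fun e : Sym2 (Fin n) =>
          if (∀ x ∈ e, x ∈ O) ∧ ¬ e.IsDiag then 1 else w e)).real
          (⋃ o ∈ O, openConn o b) ≤
        ∑ a ∈ D, (1 - (prodBernoulli (fun e : Sym2 (Fin n) =>
          if (∀ x ∈ e, x ∈ O) ∧ ¬ e.IsDiag then 1 else w e)).real (openConn a b)) := by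
    have hOA : Disjoint O A := Finset.disjoint_of_subset_left hOR hRA
    have hbO : b ∉ O := fun h => Finset.disjoint_left.1 hOA h hbA
    refine sigmaRec_engine_multi w
      (fun e : Sym2 (Fin n) => if (∀ x ∈ e, x ∈ O) ∧ ¬ e.IsDiag then 1 else w e)
      (fun (S : Finset (Fin n)) (e : Sym2 (Fin n)) =>
        if (∀ x ∈ e, x ∈ S) ∧ ¬ e.IsDiag then 1 else if (∃ x ∈ e, x ∈ O) then 0 else w e)
      O A D b
      (fun (S : Finset (Fin n)) (ω : BondConfig (Fin n)) =>
        {e | e ∈ ω ∧ ∀ x ∈ e, x ∉ O} ∪ {e | (∀ x ∈ e, x ∈ S) ∧ ¬ e.IsDiag})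
      {ω | ∀ o ∈ O, ∀ o' ∈ O, o ≠ o' → s(o, o') ∈ ω} ?_ ?_ ?_ ?_ ?_ (stub_sigmaLaw n w O) ?_
      hSteiner
    · intro ω hω
      simp only [Set.mem_setOf_eq] at hω
      push Not at hω
      obtain ⟨o, ho, o', ho', hne, hnot⟩ := hω
      refine ⟨s(o, o'), ?_, hnot⟩
      show (if (∀ y ∈ s(o, o'), y ∈ O) ∧ ¬ (s(o, o')).IsDiag then (1 : unitInterval)
        else w s(o, o')) = 1
      rw [if_pos]
      refine ⟨fun y hy => ?_, fun hd => hne (Sym2.mk_isDiag_iff.1 hd)⟩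
      rcases Sym2.mem_iff.1 hy with rfl | rfl <;> assumption
    · intro o x hx
      show (if (∀ y ∈ s(o, x), y ∈ O) ∧ ¬ (s(o, x)).IsDiag then (1 : unitInterval)
        else w s(o, x)) = w s(o, x)
      rw [if_neg]
      rintro ⟨h, -⟩
      exact hx (h x (Sym2.mem_mk_right o x))
    · intro S ω hL hK
      exact (stub_sigmaGeometry n O S ω hL hK).1 A hOA
    · intro S ω hL hK
      have h := (stub_sigmaGeometry n O S ω hL hK).1 {b} (Finset.disjoint_singleton_right.2 hbO)
      simpa only [Finset.set_biUnion_singleton] using h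
    · intro a ha S ω hL hK
      have haO : a ∉ O := fun h => Finset.disjoint_left.1 hOA h (hDA ha)
      exact (stub_sigmaGeometry n O S ω hL hK).2 a b haO hbO
    · -- a positive layer meeting `A` at `v`: KN Lemma 5 with the witness dominated at `U = O`
      intro S hS hSA hbS
      obtain ⟨v, hv⟩ := hSA
      rw [Finset.mem_inter] at hv
      obtain ⟨-, o, ho, hw⟩ := hS v hv.1
      obtain ⟨a, haD, hle⟩ := hdom O (Finset.Subset.refl O) hOR v hv.2 ⟨o, ho, hw⟩
      exact ⟨a, haD, stub_gluingLemma5 n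
        (fun e : Sym2 (Fin n) => if (∃ x ∈ e, x ∈ O) then 0 else w e) S a v b hv.1 hbS hle⟩

/-- **Near-one gluing with finitely many switching witnesses (observer form, any depth).**  `o ∈ R`, `R`
disjoint from `A` and closed under positive pairs towards non-relays, `b ∈ A`, `D ⊆ A`, and for every
`o ∈ U ⊆ R` and every relay `v` receiving a positive pair from `U` some `a ∈ D` with
`P_{G−U}(a ↔ b) ≤ P_{G−U}(v ↔ b)`.  Then `P(o ↔ A) − P(o ↔ b) ≤ Σ_{a∈D} (1 − P(a ↔ b))`.
[cite: KozmaNitzan2024, Thm. 4 (pp. 12–14) — the case `R = {o}`, `|D| = 1`] -/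
theorem nearOneGluing_of_fewWitnesses (n : ℕ) (w : Sym2 (Fin n) → unitInterval)
    (A D R : Finset (Fin n)) (o b : Fin n) (hoR : o ∈ R) (hRA : Disjoint R A) (hbA : b ∈ A)
    (hDA : D ⊆ A) (hclosed : ∀ x ∈ R, ∀ y : Fin n, y ∉ R → y ∉ A → w s(x, y) = 0)
    (hdom : ∀ U : Finset (Fin n), o ∈ U → U ⊆ R → ∀ v ∈ A, (∃ x ∈ U, w s(x, v) ≠ 0) → ∃ a ∈ D,
      (prodBernoulli (fun e : Sym2 (Fin n) => if (∃ x ∈ e, x ∈ U) then 0 else w e)).real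
          (openConn a b) ≤
        (prodBernoulli (fun e : Sym2 (Fin n) => if (∃ x ∈ e, x ∈ U) then 0 else w e)).real
          (openConn v b)) :
    (prodBernoulli w).real (⋃ a ∈ A, openConn o a) - (prodBernoulli w).real (openConn o b) ≤
      ∑ a ∈ D, (1 - (prodBernoulli w).real (openConn a b)) := by
  have key := fewWitness_blockGluing A D b hbA hDA R hRA n w {o} (Finset.singleton_subset_iff.2 hoR)
    hclosed (fun U hoU hUR v hv hadj => hdom U (Finset.singleton_subset_iff.1 hoU) hUR v hv hadj)
    ((Finset.card_le_univ _).trans (Fintype.card_fin n).le)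
  rw [goodStep24_glue_singleton, Finset.set_biUnion_singleton, Finset.set_biUnion_singleton] at key
  exact key

/-- **Witness switching costs one `t` per witness**: under the hypotheses of
`nearOneGluing_of_fewWitnesses`, if every witness `a ∈ D` has `P(a ↔ b) ≥ 1 − t`, then
`P(o ↔ A) − |D|·t ≤ P(o ↔ b)`.  [cite: KozmaNitzan2024, Conj. 3 (p. 15) — context] -/
theorem nearOneGluing_of_fewWitnesses_le (n : ℕ) (w : Sym2 (Fin n) → unitInterval)
    (A D R : Finset (Fin n)) (o b : Fin n) (t : ℝ) (hoR : o ∈ R) (hRA : Disjoint R A) (hbA : b ∈ A)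
    (hDA : D ⊆ A) (hclosed : ∀ x ∈ R, ∀ y : Fin n, y ∉ R → y ∉ A → w s(x, y) = 0)
    (hdom : ∀ U : Finset (Fin n), o ∈ U → U ⊆ R → ∀ v ∈ A, (∃ x ∈ U, w s(x, v) ≠ 0) → ∃ a ∈ D,
      (prodBernoulli (fun e : Sym2 (Fin n) => if (∃ x ∈ e, x ∈ U) then 0 else w e)).real
          (openConn a b) ≤
        (prodBernoulli (fun e : Sym2 (Fin n) => if (∃ x ∈ e, x ∈ U) then 0 else w e)).real
          (openConn v b))
    (hrel : ∀ a ∈ D, 1 - t ≤ (prodBernoulli w).real (openConn a b)) :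
    (prodBernoulli w).real (⋃ a ∈ A, openConn o a) - D.card * t ≤
      (prodBernoulli w).real (openConn o b) := by
  have key := nearOneGluing_of_fewWitnesses n w A D R o b hoR hRA hbA hDA hclosed hdom
  have hsum : ∑ a ∈ D, (1 - (prodBernoulli w).real (openConn a b)) ≤ ∑ _a ∈ D, t :=
    Finset.sum_le_sum fun a ha => by linarith [hrel a ha]
  rw [Finset.sum_const, nsmul_eq_mul] at hsum
  linarith

end

end Summit.CriticalPhenomena.PercolationContinuityZ3.Theorems
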